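import Mathlib
import Summits.NavierStokesRegularity.NavierStokesRegularity.Theorems.RossbyDichotomyStretchingAtMaxCriterionComparison
import Summits.NavierStokesRegularity.NavierStokesRegularity.Theorems.RossbyDichotomyStretchingAtMaxCriterionTools
import Summits.NavierStokesRegularity.NavierStokesRegularity.Theses.RossbyDichotomy
import HarnessLib

/-!
# `RossbyDichotomy.StretchingAtMaxCriterion` — the stretching-at-the-maximum continuation criterion
  (item stmt-NavierStokesRegularity-2923)

**Statement.** `ν > 0`, `T > 0`, `(u, p)` a classical Navier–Stokes solution on `ℝ³ × [0, T)`,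
Leray–Hopf on `[0, T]` from a rapidly decaying datum. If there is `g ∈ L¹(0, T)` with
`⟪ω, Du ω⟫(t, x) ≤ g(t) ‖ω(t, x)‖²` at every spatial maximum point `x` of `‖ω(t, ·)‖`, `t ∈ [0, T)`
(`ω = curl u`), then the solution extends smoothly past `T`.

PROOF (folklore; Constantin 1994 / Chae 2008 for Euler — the viscous term has the good sign at a
maximum).
1. `M(t) := maxₓ ‖ω(t, x)‖²` is attained (`StretchingAtMax.exists_argmax_curl`: `ω(t, ·)` is
   Lipschitz and square integrable in Tao's class, hence `→ 0` at infinity) and continuous on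
   `[0, T)` (time-Lipschitz on closed sub-slabs: `|∂ₜ‖ω‖²| ≤ 2 W L` from `slab_bounds`).
2. At `t ∈ (0, T)` and a maximiser `x*`, `φ(s) := ‖ω(s, x*)‖²` touches `M` from below at `t` and
   `φ'(t) = 2⟪ω, ∂ₜω⟫ ≤ 2⟪ω, Du ω⟫(t, x*) ≤ 2 g(t) M(t)`
   (`StretchingAtMax.deriv_normSq_curl_le_at_argmax` + the hypothesis at the maximum point `x*`).
3. The Dini comparison lemma with the `L¹` rate `2g` (`StretchingAtMax.bounded_of_touching`,
   Vitali–Carathéodory majorant + first crossing) bounds `M` on `[0, T)`, i.e. `‖ω‖ ≤ √K`.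
4. A uniform vorticity bound continues the solution (`hasSmoothExtensionPast_of_curl_bounded`:
   `ω ∈ L^{5/2}_{t,x}` and the tree's unconditional Beirão da Veiga vorticity criterion).

HONEST FRAMING: a conditional continuation criterion about HYPOTHETICAL smooth solutions up to a
putative singular time; nothing here bears on the regularity problem itself.
-/

noncomputable section

set_option linter.dupNamespace false

namespace Summit.NavierStokesRegularity.NavierStokesRegularity.Theorems

open MeasureTheory Set Filter Topology Literature.Analysis.FluidPDE
open scoped RealInnerProductSpace

open StretchingAtMax in
/-- **Item stmt-NavierStokesRegularity-2923** (`RossbyDichotomy.StretchingAtMaxCriterion`): the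
stretching-at-the-vorticity-maximum continuation criterion for classical Leray–Hopf solutions of
Navier–Stokes from rapidly decaying data. [cite: Constantin1994, §2 (geometric depletion at vorticity maxima)] -/
theorem rossbyDichotomy_stretchingAtMaxCriterion_proof :
    Summit.NavierStokesRegularity.NavierStokesRegularity.Theses.RossbyDichotomy.StretchingAtMaxCriterion := by
  unfold Summit.NavierStokesRegularity.NavierStokesRegularity.Theses.RossbyDichotomy.StretchingAtMaxCriterion
  intro ν T hν hT u p hsol hLH hdec hyp
  obtain ⟨g, hg, hstretch⟩ := hyp
  classical
  -- 1. maximisers and the envelope `M`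
  have hargmax : ∀ t ∈ Ico 0 T, ∃ xm : EuclideanSpace ℝ (Fin 3),
      ∀ y, ‖curl (u t) y‖ ≤ ‖curl (u t) xm‖ :=
    fun t ht => exists_argmax_curl hν hT hsol hLH hdec ht
  choose! xm hxm using hargmax
  set M : ℝ → ℝ := fun t => ‖curl (u t) (xm t)‖ ^ 2 with hM
  have hM0 : ∀ t ∈ Ico 0 T, 0 ≤ M t := fun t _ => sq_nonneg _
  have hMmax : ∀ t ∈ Ico 0 T, ∀ y, ‖curl (u t) y‖ ^ 2 ≤ M t := fun t ht y =>
    pow_le_pow_left₀ (norm_nonneg _) (hxm t ht y) 2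
  -- continuity of `M` on `[0, T)`: time-Lipschitz on closed sub-slabs
  have hLip : ∀ T', 0 < T' → T' < T → ∃ C, ∀ s ∈ Icc 0 T', ∀ t ∈ Icc 0 T',
      |M t - M s| ≤ C * |t - s| := by
    intro T' hT'0 hT'
    obtain ⟨W, L, D, hW, hL, -, hωb, hωt, -, -⟩ := slab_bounds hν hsol hLH hdec hT'0 hT'
    have hsub : Icc 0 T' ⊆ Ico 0 T := Icc_subset_Ico_right hT'
    -- pointwise: `|‖ω t x‖² - ‖ω s x‖²| ≤ 2 W L |t - s|`
    have hpt : ∀ x, ∀ s ∈ Icc 0 T', ∀ t ∈ Icc 0 T',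
        |‖curl (u t) x‖ ^ 2 - ‖curl (u s) x‖ ^ 2| ≤ 2 * W * L * |t - s| := by
      intro x s hs t ht
      have hderiv : ∀ τ ∈ Icc 0 T', HasDerivWithinAt (fun σ => ‖curl (u σ) x‖ ^ 2)
          (2 * ⟪curl (u τ) x, timeDerivWithin (Ico 0 T) (vorticity u) τ x⟫) (Icc 0 T') τ :=
        fun τ hτ => ((hasDerivWithinAt_curl hsol (hsub hτ) x).mono hsub).norm_sq
      have hbound : ∀ τ ∈ Icc 0 T',
          ‖2 * ⟪curl (u τ) x, timeDerivWithin (Ico 0 T) (vorticity u) τ x⟫‖ ≤ 2 * W * L := by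
        intro τ hτ
        rw [Real.norm_eq_abs, abs_mul, abs_two]
        have h := abs_real_inner_le_norm (curl (u τ) x) (timeDerivWithin (Ico 0 T) (vorticity u) τ x)
        have h2 := mul_le_mul (hωb τ hτ x) (hωt τ hτ x) (norm_nonneg _) hW
        nlinarith
      have h := (convex_Icc 0 T').norm_image_sub_le_of_norm_hasDerivWithin_le hderiv hbound hs ht
      rw [Real.norm_eq_abs, Real.norm_eq_abs] at h
      exact h
    refine ⟨2 * W * L, fun s hs t ht => ?_⟩
    have h1 := hpt (xm t) s hs t ht
    have h2 := hpt (xm s) s hs t ht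
    have h3 : ‖curl (u t) (xm s)‖ ^ 2 ≤ M t := hMmax t (hsub ht) (xm s)
    have h4 : ‖curl (u s) (xm t)‖ ^ 2 ≤ M s := hMmax s (hsub hs) (xm t)
    rw [abs_le] at h1 h2 ⊢
    constructor <;> [linarith [h2.1]; linarith [h1.2]]
  have hMcont : ContinuousOn M (Ico 0 T) := by
    intro t₀ ht₀
    set T' : ℝ := (t₀ + T) / 2 with hT'def
    have hT'0 : 0 < T' := by rw [hT'def]; linarith [ht₀.1]
    have hT' : T' < T := by rw [hT'def]; linarith [ht₀.2]
    have ht₀T' : t₀ < T' := by rw [hT'def]; linarith [ht₀.2]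
    obtain ⟨C, hC⟩ := hLip T' hT'0 hT'
    have hC0 : 0 ≤ C := by
      have := hC t₀ ⟨ht₀.1, ht₀T'.le⟩ T' ⟨hT'0.le, le_rfl⟩
      have hpos : 0 < |T' - t₀| := abs_pos.2 (by linarith)
      nlinarith [abs_nonneg (M T' - M t₀)]
    have hLipOn : LipschitzOnWith ⟨C, hC0⟩ M (Icc 0 T') :=
      LipschitzOnWith.of_dist_le_mul fun s hs t ht => by
        rw [Real.dist_eq, Real.dist_eq]; exact hC t ht s hs
    have hcw : ContinuousWithinAt M (Icc 0 T') t₀ := hLipOn.continuousOn t₀ ⟨ht₀.1, ht₀T'.le⟩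
    refine hcw.mono_of_mem_nhdsWithin ?_
    refine mem_nhdsWithin.2 ⟨Iio T', isOpen_Iio, ht₀T', fun s hs => ⟨hs.2.1, le_of_lt hs.1⟩⟩
  -- 2. touching from below at interior times, with rate `2 g`
  have htouch : ∀ t ∈ Ioo 0 T, ∃ φ : ℝ → ℝ, ∃ d : ℝ,
      φ t = M t ∧ (∀ s ∈ Icc 0 t, φ s ≤ M s) ∧ HasDerivAt φ d t ∧ d ≤ (2 * g t) * M t := by
    intro t ht
    have htI : t ∈ Ico 0 T := ⟨ht.1.le, ht.2⟩
    obtain ⟨d, hd, hdle⟩ := deriv_normSq_curl_le_at_argmax hν hsol ht (hxm t htI)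
    refine ⟨fun s => ‖curl (u s) (xm t)‖ ^ 2, d, rfl, fun s hs => ?_, hd, ?_⟩
    · exact hMmax s ⟨hs.1, hs.2.trans_lt ht.2⟩ (xm t)
    · have h := hstretch t htI (xm t) (hxm t htI)
      have : (2 * g t) * M t = 2 * (g t * ‖curl (u t) (xm t)‖ ^ 2) := by rw [hM]; ring
      rw [this]
      linarith
  -- 3. the Dini comparison lemma bounds `M` on `[0, T)`
  obtain ⟨K, hK⟩ := bounded_of_touching (g := fun t => 2 * g t) hT hMcont hM0 (hg.const_mul 2) htouch
  -- 4. continuation from the vorticity bound `‖ω‖ ≤ √K`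
  refine hasSmoothExtensionPast_of_curl_bounded hν hT hsol hLH hdec (K := Real.sqrt K) fun t ht x => ?_
  calc ‖curl (u t) x‖ = Real.sqrt (‖curl (u t) x‖ ^ 2) := (Real.sqrt_sq (norm_nonneg _)).symm
    _ ≤ Real.sqrt K := Real.sqrt_le_sqrt ((hMmax t ht x).trans (hK t ht))

end Summit.NavierStokesRegularity.NavierStokesRegularity.Theorems

end
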